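import Literature.NumberTheory.Automorphic.QuadraticHeckeCharacterCM
import Literature.NumberTheory.Automorphic.QuadraticHeckeCharacterLocalComponent
import Literature.NumberTheory.QuadraticForms.HilbertReciprocityFiniteness
import HarnessLib

/-!
# The quadratic Hecke character `ω_{E/F}` of an ARBITRARY quadratic extension of number fields

Topic `NumberTheory/Automorphic`; namespace `Literature.NumberTheory.Automorphic`. Two definitions (a choice of
an integral generator, the character) and their API; everything is proved, no named fact, no instance.

Let `E/F` be a quadratic extension of number fields (Mathlib `Algebra.IsQuadraticExtension F E`). By the tree's
`exists_integer_sq_eq_of_finrank_eq_two` (`QuadraticHeckeCharacter.lean`), `E = F(√θ)` for an algebraic integer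
`θ ∈ 𝓞 F` having a square root `α ∈ E ∖ F`; the square class `θ · F^{×2}` is determined by `E/F`
(`exists_eq_mul_sq_of_sq_eq`: two such presentations differ by the square of an element of `F`).

* `quadExtGenerator F E : 𝓞 F` — a choice of such a `θ` (`quadExtGenerator_spec`, `not_isSquare_quadExtGenerator`);
* **`quadraticHeckeCharExt F E : HeckeCharacter F`** — `ω_{E/F} := quadraticHeckeChar F θ`, the tree's quadratic
  Hecke character of `F(√θ)/F` (`QuadraticHeckeCharacter.lean`: the sign character of the index-two open subgroup
  `P_F · N_{E/F} J_E` of `𝕀_F`, O'Meara 65:21) — "the character of `I_F` associated to `E/F` by class field theory"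
  ([GelbartRogawski1991] §1.1 p. 449 L28, `ω_{E/F}`; [HarrisKudlaSweet1996] (0.9) p. 944, `ε_{E/F}`);
* `quadraticHeckeCharExt_eq_quadraticHeckeChar` — **independence of the choice**: for EVERY integral
  presentation `E = F(β)`, `β² = θ' ∈ 𝓞 F`, `β ∉ F`, `quadraticHeckeChar F θ' = quadraticHeckeCharExt F E`
  (`quadraticHeckeChar_eq_of_mul_sq`);
* values: `quadraticHeckeCharExt_apply_sq` (`ω(x)² = 1`), `quadraticHeckeCharExt_sq`, `quadraticHeckeCharExt_ne_one`,
  `norm_quadraticHeckeCharExt_apply` (`|ω(x)| = 1`), `isUnitary_quadraticHeckeCharExt`,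
  `isFiniteOrder_quadraticHeckeCharExt`;
* **local components at the finite places** — `quadraticHeckeCharExt_localUnits`: for ANY `δ ∈ E` with
  `c δ = -δ ≠ 0` for an `F`-automorphism `c` of `E` (so `δ ∉ F`, `c ≠ 1`) and `δ² = d ∈ F` (not necessarily
  integral), `ω(⟨a⟩_v) = (d, a)_v` (Hilbert symbol of `F_v`) for every finite place `v` of `F` and `a ∈ F_vˣ`
  (tree `quadraticHeckeChar_localUnits`, `d = θ t²`);
* **the CM field case** — `quadraticHeckeCharCM_eq_quadraticHeckeCharExt`: for a CM field `L`,
  `quadraticHeckeCharCM L = quadraticHeckeCharExt L⁺ L` (`QuadraticHeckeCharacterCM.lean`'s `ε_{L/L⁺}`).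

Written for the general-`(F, E, σ)` programme of the kernel proof of [GelbartRogawski1991, Prop. 3.1.1]
(`Prop311AsPrinted` quantifies over every quadratic extension `E/F`; the tree's construction behind the cited input
`hGRU` of the Hodge-CM period-theorem package was typed at CM data `(L⁺, L)` only).  Nothing in this file is a claim
of the manuscripts adjudicated by that cell.

## References

* O. T. O'Meara, *Introduction to Quadratic Forms*, Grundlehren 117 (1963), §65A Example 65:2, §65D Prop. 65:21,
  §71D proof of Thm. 71:19. [Omeara1963]
* S. Gelbart, J. Rogawski, *L-functions and Fourier–Jacobi coefficients for the unitary group U(3)*, Invent. Math.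
  105 (1991), §1.1 p. 449. [GelbartRogawski1991]
* M. Harris, S. Kudla, W. Sweet, *Theta dichotomy for unitary groups*, JAMS 9 (1996), (0.9), §1 (1.5).
  [HarrisKudlaSweet1996]
* S. Lang, *Algebra*, rev. 3rd ed., GTM 211 (2002), Ch. VI §6 (cyclic extensions, Thm. 6.2), §8 (Kummer theory,
  Thm. 8.1). [Lang2002]
-/

set_option autoImplicit false

noncomputable section

open scoped NumberField
open NumberField IsDedekindDomain

namespace Literature.NumberTheory.Automorphic

open QuadraticForms GaloisRepresentations Literature.NumberTheory.NumberFields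
open Literature.NumberTheory.QuadraticForms.QuadraticExtension

section General

variable (F E : Type) [Field F] [NumberField F] [Field E] [Algebra F E] [Algebra.IsQuadraticExtension F E]

/-! ## Generalities on square roots in a quadratic extension -/

variable {F E} in
omit [Algebra.IsQuadraticExtension F E] in
/-- an element `δ` with `c δ = -δ ≠ 0` for an `F`-automorphism `c` is not in `F` (characteristic `0`).
[cite: Lang2002, Ch. VI §6 Thm. 6.2] -/
theorem algebraMap_ne_of_algEquiv_apply_eq_neg (c : E ≃ₐ[F] E) {δ : E} (hcδ : c δ = -δ) (hδ : δ ≠ 0)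
    (r : F) : algebraMap F E r ≠ δ := by
  haveI : CharZero E := charZero_of_injective_algebraMap (algebraMap F E).injective
  intro hr
  have h1 : c δ = δ := by rw [← hr, AlgEquiv.commutes]
  rw [hcδ, neg_eq_iff_add_eq_zero, ← two_mul, mul_eq_zero] at h1
  rcases h1 with h1 | h1
  · exact two_ne_zero h1
  · exact hδ h1

variable {F E} in
/-- **two square roots of elements of `F` lying outside `F` differ by a factor from `F`**: if `α, β ∈ E ∖ F` with
`α² = θ ∈ F`, `β² = θ' ∈ F`, then `θ' = θ r²` for some `r ∈ F`, `r ≠ 0` (`β / α` is fixed by the non-trivial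
automorphism) — Kummer theory in degree `2`: `F(√θ) = F(√θ')` iff `θ F^{×2} = θ' F^{×2}`. [cite: Lang2002, Ch. VI §8 Thm. 8.1] -/
theorem exists_eq_mul_sq_of_sq_eq {θ θ' : F} {α β : E} (hα : α ^ 2 = algebraMap F E θ)
    (hαF : ∀ r : F, algebraMap F E r ≠ α) (hβ : β ^ 2 = algebraMap F E θ') (hβF : ∀ r : F, algebraMap F E r ≠ β) :
    ∃ r : F, r ≠ 0 ∧ θ' = θ * r ^ 2 := by
  haveI : CharZero F := inferInstance
  obtain ⟨σ, hσ⟩ := exists_algEquiv_ne_one (K := F) (E := E)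
  have hσα : σ α = -α := algEquiv_apply_eq_neg hσ hα hαF
  have hσβ : σ β = -β := algEquiv_apply_eq_neg hσ hβ hβF
  have hα0 : α ≠ 0 := ne_zero_of_sq_eq' hα hαF
  have hβ0 : β ≠ 0 := ne_zero_of_sq_eq' hβ hβF
  have hfix : σ (β / α) = β / α := by rw [map_div₀, hσα, hσβ, neg_div_neg_eq]
  obtain ⟨r, hr⟩ := exists_algebraMap_eq_of_fixed hσ hfix
  refine ⟨r, fun h => ?_, (algebraMap F E).injective ?_⟩
  · rw [h, map_zero, eq_comm, div_eq_zero_iff] at hr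
    rcases hr with h' | h'
    · exact hβ0 h'
    · exact hα0 h'
  · rw [map_mul, map_pow, hr, ← hα, ← hβ, div_pow, mul_div_cancel₀ _ (pow_ne_zero 2 hα0)]

variable {F E} in
omit [NumberField F] [Algebra.IsQuadraticExtension F E] in
/-- if `β² = θ' ∈ F` with `β ∉ F` then `θ'` is not a square in `F`. [cite: Lang2002, Ch. VI §6 Thm. 6.2] -/
theorem not_isSquare_of_sq_eq {θ' : F} {β : E} (hβ : β ^ 2 = algebraMap F E θ')
    (hβF : ∀ r : F, algebraMap F E r ≠ β) : ¬ IsSquare θ' := by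
  rintro ⟨s, hs⟩
  have h : β ^ 2 = (algebraMap F E s) ^ 2 := by rw [hβ, hs, map_mul, sq]
  rcases eq_or_eq_neg_of_sq_eq_sq _ _ h with h1 | h1
  · exact hβF s h1.symm
  · exact hβF (-s) (by rw [map_neg, h1])

/-! ## The generator `θ` -/

/-- `E = F(√θ)` with `θ ∈ 𝓞 F`: existence (tree `exists_integer_sq_eq_of_finrank_eq_two`; a quadratic extension in
characteristic `0` is a Kummer extension, and the radicand may be scaled by a square into `𝓞 F`).
[cite: Lang2002, Ch. VI §6 Thm. 6.2] -/
theorem exists_quadExtGenerator :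
    ∃ (θ : 𝓞 F) (α : E), θ ≠ 0 ∧ α ^ 2 = algebraMap F E (θ : F) ∧ ∀ r : F, algebraMap F E r ≠ α :=
  exists_integer_sq_eq_of_finrank_eq_two (Algebra.IsQuadraticExtension.finrank_eq_two F E)

/-- **A choice of `θ ∈ 𝓞 F` with `E = F(√θ)`.** [cite: Lang2002, Ch. VI §6 Thm. 6.2] -/
def quadExtGenerator : 𝓞 F :=
  (exists_quadExtGenerator F E).choose

/-- the defining property of `quadExtGenerator`: a square root `α ∈ E ∖ F`. [cite: Lang2002, Ch. VI §6 Thm. 6.2] -/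
theorem quadExtGenerator_spec :
    ∃ α : E, α ^ 2 = algebraMap F E (quadExtGenerator F E : F) ∧ ∀ r : F, algebraMap F E r ≠ α := by
  obtain ⟨α, -, h2, h3⟩ := (exists_quadExtGenerator F E).choose_spec
  exact ⟨α, h2, h3⟩

/-- `θ ≠ 0`. [cite: Lang2002, Ch. VI §6 Thm. 6.2] -/
theorem quadExtGenerator_ne_zero : quadExtGenerator F E ≠ 0 :=
  (exists_quadExtGenerator F E).choose_spec.choose_spec.1

/-- `θ` is a non-square in `F`. [cite: Lang2002, Ch. VI §6 Thm. 6.2] -/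
theorem not_isSquare_quadExtGenerator : ¬ IsSquare (quadExtGenerator F E : F) := by
  obtain ⟨α, hα, hαF⟩ := quadExtGenerator_spec F E
  exact not_isSquare_of_sq_eq hα hαF

/-! ## The character -/

/-- **The quadratic Hecke character `ω_{E/F}` of the quadratic extension `E/F`**: the tree's
`quadraticHeckeChar F θ` for `θ = quadExtGenerator F E` — the character of `𝕀_F` with kernel `P_F · N_{E/F} J_E`
(index `2`, O'Meara 65:21), "the character of `I_F` associated to `E/F` by class field theory".
[cite: GelbartRogawski1991, §1.1 p. 449 L28; Omeara1963, §65D Prop. 65:21] -/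
def quadraticHeckeCharExt : HeckeCharacter F :=
  quadraticHeckeChar F (quadExtGenerator F E) (not_isSquare_quadExtGenerator F E)

/-- Unfolding: `ω_{E/F}` is the sign character of `P_F · N_{E/F} J_E`. [cite: Omeara1963, §65D Prop. 65:21] -/
theorem quadraticHeckeCharExt_def :
    quadraticHeckeCharExt F E = quadraticHeckeChar F (quadExtGenerator F E) (not_isSquare_quadExtGenerator F E) :=
  rfl

variable {F E}

/-- **Kernel**: `ω(x) = 1` iff `x ∈ P_F · N J` (principal idèles times the idèles that are local norms from
`F_v(√θ)` everywhere). [cite: Omeara1963, §65A Example 65:2] -/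
theorem quadraticHeckeCharExt_apply_eq_one_iff (x : ideleGroup F) :
    quadraticHeckeCharExt F E x = 1 ↔ x ∈ principalIdeles F ⊔ normIdeles F (quadExtGenerator F E : F) := by
  refine ⟨fun h => ?_, fun h => quadraticHeckeChar_apply_of_mem _ h⟩
  by_contra hx
  rw [quadraticHeckeCharExt_def, quadraticHeckeChar_apply_of_not_mem _ hx] at h
  exact (neg_ne_self.2 one_ne_zero) (Units.ext_iff.1 h)

/-- `ω(x)² = 1` (the kernel has index `2`). [cite: Omeara1963, §65D Prop. 65:21] -/
theorem quadraticHeckeCharExt_apply_sq (x : ideleGroup F) : quadraticHeckeCharExt F E x ^ 2 = 1 :=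
  quadraticHeckeChar_apply_sq _ x

variable (F E) in
/-- `ω² = 1` in the group of Hecke characters. [cite: Omeara1963, §65D Prop. 65:21] -/
theorem quadraticHeckeCharExt_sq : quadraticHeckeCharExt F E ^ 2 = 1 :=
  HeckeCharacter.ext fun x => by
    rw [HeckeCharacter.pow_apply, quadraticHeckeCharExt_apply_sq, HeckeCharacter.one_apply]

variable (F E) in
/-- `ω` has finite order (`ω² = 1`). [cite: Omeara1963, §65D Prop. 65:21] -/
theorem isFiniteOrder_quadraticHeckeCharExt : (quadraticHeckeCharExt F E).IsFiniteOrder :=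
  isFiniteOrder_quadraticHeckeChar _

variable (F E) in
/-- **`ω ≠ 1`**: the kernel `P_F · N J` has index `2`, so some idèle lies outside it. [cite: Omeara1963, §65D Prop. 65:21] -/
theorem quadraticHeckeCharExt_ne_one : quadraticHeckeCharExt F E ≠ 1 := by
  intro h
  have hidx := index_principalIdeles_sup_normIdeles F (quadExtGenerator F E : F) (not_isSquare_quadExtGenerator F E)
  have htop : principalIdeles F ⊔ normIdeles F (quadExtGenerator F E : F) = ⊤ := by
    rw [Subgroup.eq_top_iff']
    intro x
    rw [← quadraticHeckeCharExt_apply_eq_one_iff, h, HeckeCharacter.one_apply]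
  rw [htop, Subgroup.index_top] at hidx
  exact absurd hidx (by norm_num)

/-- The values of `ω` have norm `1` (they are `±1`). [cite: Omeara1963, §65D Prop. 65:21] -/
theorem norm_quadraticHeckeCharExt_apply (x : ideleGroup F) : ‖((quadraticHeckeCharExt F E x : ℂˣ) : ℂ)‖ = 1 := by
  have h : ((quadraticHeckeCharExt F E x : ℂˣ) : ℂ) ^ 2 = 1 := by
    rw [← Units.val_pow_eq_pow_val, quadraticHeckeCharExt_apply_sq, Units.val_one]
  have h' : ‖((quadraticHeckeCharExt F E x : ℂˣ) : ℂ)‖ ^ 2 = 1 := by rw [← norm_pow, h, norm_one]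
  exact (pow_eq_one_iff_of_nonneg (norm_nonneg _) two_ne_zero).1 h'

variable (F E) in
/-- **`ω` is unitary** ("a unitary character … whose restriction to `I_F` is `ω_{E/F}`" makes sense).
[cite: GelbartRogawski1991, §3.1 p. 456; Omeara1963, §65D Prop. 65:21] -/
theorem isUnitary_quadraticHeckeCharExt : (quadraticHeckeCharExt F E).IsUnitary :=
  fun x => norm_quadraticHeckeCharExt_apply x

/-! ## Independence of the choice of `θ` -/

variable (F E) in
/-- **`ω_{E/F}` does not depend on the presentation `E = F(√θ')`.** If `β ∈ E ∖ F` has `β² = θ' ∈ 𝓞 F` then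
`quadraticHeckeChar F θ' = quadraticHeckeCharExt F E` (`θ' = θ r²` with `r ∈ F`, and the character only depends
on the square class). [cite: Omeara1963, §65A Example 65:2] -/
theorem quadraticHeckeCharExt_eq_quadraticHeckeChar {θ' : 𝓞 F} {β : E} (hβ2 : β ^ 2 = algebraMap F E (θ' : F))
    (hβ : ∀ r : F, algebraMap F E r ≠ β) (hθ' : ¬ IsSquare (θ' : F)) :
    quadraticHeckeChar F θ' hθ' = quadraticHeckeCharExt F E := by
  obtain ⟨α, hα2, hαF⟩ := quadExtGenerator_spec F E
  obtain ⟨r, hr0, hr⟩ := exists_eq_mul_sq_of_sq_eq hα2 hαF hβ2 hβ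
  exact quadraticHeckeChar_eq_of_mul_sq (not_isSquare_quadExtGenerator F E) hθ' hr0 hr

/-! ## Local components at the finite places: Hilbert symbols -/

/-- `δ² = θ t²` with `t ∈ F`, `t ≠ 0`, for every `δ ∈ E ∖ F` with `δ² = d ∈ F` (`θ = quadExtGenerator F E`).
[cite: Lang2002, Ch. VI §8 Thm. 8.1] -/
theorem exists_sq_eq_quadExtGenerator_mul_sq {δ : E} (hδF : ∀ r : F, algebraMap F E r ≠ δ) {d : F}
    (hd : δ * δ = algebraMap F E d) :
    ∃ t : F, t ≠ 0 ∧ d = (quadExtGenerator F E : F) * t ^ 2 := by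
  obtain ⟨α, hα2, hαF⟩ := quadExtGenerator_spec F E
  have hδ2 : δ ^ 2 = algebraMap F E d := by rw [sq, hd]
  exact exists_eq_mul_sq_of_sq_eq hα2 hαF hδ2 hδF

/-- **The local components of `ω_{E/F}` are the Hilbert symbols `(d, ·)_v`**: for every `δ ∈ E` with `c δ = -δ ≠ 0`
for an `F`-automorphism `c` of `E` and `δ² = d ∈ F`, every finite place `v` of `F` and every `a ∈ F_vˣ`,
`ω(⟨a⟩_v) = (d, a)_v` (tree `quadraticHeckeChar_localUnits`: `ω(⟨a⟩_v) = (a, θ)_v`, and `d = θ t²`).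
[cite: Omeara1963, §71D proof of Thm. 71:19; HarrisKudlaSweet1996, §1 (1.5)] -/
theorem quadraticHeckeCharExt_localUnits (c : E ≃ₐ[F] E) {δ : E} (hcδ : c δ = -δ) (hδ : δ ≠ 0) {d : F}
    (hd : δ * δ = algebraMap F E d) (v : HeightOneSpectrum (𝓞 F)) (a : (v.adicCompletion F)ˣ) :
    ((quadraticHeckeCharExt F E (localUnits v a) : ℂˣ) : ℂ) =
      hilbertSymbol (v.adicCompletion F) ((d : F) : v.adicCompletion F) (a : v.adicCompletion F) := by
  have hδF := algebraMap_ne_of_algEquiv_apply_eq_neg c hcδ hδ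
  obtain ⟨t, ht0, ht⟩ := exists_sq_eq_quadExtGenerator_mul_sq hδF hd
  have htv : algebraMap F (v.adicCompletion F) t ≠ 0 := (_root_.map_ne_zero _).2 ht0
  have ht' : ((d : F) : v.adicCompletion F) =
      algebraMap F (v.adicCompletion F) (quadExtGenerator F E : F) * (algebraMap F (v.adicCompletion F) t) ^ 2 := by
    rw [← map_pow, ← map_mul, ← ht]
    rfl
  rw [quadraticHeckeCharExt_def, quadraticHeckeChar_localUnits (not_isSquare_quadExtGenerator F E) v a, ht',
    hilbertSymbol_mul_sq_left _ _ htv, hilbertSymbol_comm]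

/-- the same for the bundled local component `ω_v = ω.localComponent v`. [cite: Omeara1963, §71D proof of Thm. 71:19] -/
theorem localComponent_quadraticHeckeCharExt (c : E ≃ₐ[F] E) {δ : E} (hcδ : c δ = -δ) (hδ : δ ≠ 0) {d : F}
    (hd : δ * δ = algebraMap F E d) (v : HeightOneSpectrum (𝓞 F)) (a : (v.adicCompletion F)ˣ) :
    ((((quadraticHeckeCharExt F E).localComponent v) a : ℂˣ) : ℂ) =
      hilbertSymbol (v.adicCompletion F) ((d : F) : v.adicCompletion F) (a : v.adicCompletion F) := by
  rw [HeckeCharacter.localComponent_apply]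
  exact quadraticHeckeCharExt_localUnits c hcδ hδ hd v a

end General

/-! ## The CM field case -/

section CM

variable (L : Type) [Field L] [NumberField L] [IsCMField L]

/-- **For a CM field `L`, `ε_{L/L⁺}` (`quadraticHeckeCharCM L`) IS `ω_{L/L⁺}` (`quadraticHeckeCharExt L⁺ L`).**
[cite: Omeara1963, §65A Example 65:2] -/
theorem quadraticHeckeCharCM_eq_quadraticHeckeCharExt :
    quadraticHeckeCharCM L = quadraticHeckeCharExt (maximalRealSubfield L) L := by
  obtain ⟨α, hα0, hαc, hα2⟩ := cmQuadraticGenerator_spec L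
  rw [quadraticHeckeCharCM_def]
  exact quadraticHeckeCharExt_eq_quadraticHeckeChar (maximalRealSubfield L) L hα2
    (algebraMap_ne_of_algEquiv_apply_eq_neg (IsCMField.complexConj L) hαc hα0) _

end CM

/-! ## Split places: `ω_v = 1` where `d` is a local square -/

section Split

variable {F E : Type} [Field F] [NumberField F] [Field E] [Algebra F E] [Algebra.IsQuadraticExtension F E]

/-- **at a finite place `v` where `d = δ²` is a square in `F_v` (a place split in `E = F(δ)`), `ω_{E/F}(⟨a⟩_v) = 1` for every
`a ∈ F_vˣ`** (`(d, a)_v = 1` for a square `d`). [cite: Omeara1963, §63B, §65A Example 65:2] -/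
theorem quadraticHeckeCharExt_localUnits_eq_one_of_isSquare (c : E ≃ₐ[F] E) {δ : E} (hcδ : c δ = -δ) (hδ : δ ≠ 0) {d : F}
    (hd : δ * δ = algebraMap F E d) (v : HeightOneSpectrum (𝓞 F)) (hsq : IsSquare ((d : F) : v.adicCompletion F))
    (a : (v.adicCompletion F)ˣ) : quadraticHeckeCharExt F E (localUnits v a) = 1 := by
  have hd0 : d ≠ 0 := by
    rintro rfl
    rw [map_zero, mul_self_eq_zero] at hd
    exact hδ hd
  have hd0' : ((d : F) : v.adicCompletion F) ≠ 0 := (_root_.map_ne_zero (algebraMap F (v.adicCompletion F))).2 hd0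
  have h := quadraticHeckeCharExt_localUnits c hcδ hδ hd v a
  rw [hilbertSymbol_eq_one_of_isSquare hsq hd0', Int.cast_one] at h
  exact Units.ext (by rw [h, Units.val_one])

end Split

end Literature.NumberTheory.Automorphic

end
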